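import Summits.ValiantsHypothesis.ValiantsHypothesis.Theorems.LacunarySymmetroidMatrixDescartesPivotRankOneCriticalWindowsLoneCubicMoment

/-!
# `MatrixDescartes` census — rank-one `(2,K)₁`, lone letter: THE CUBIC FOLD INEQUALITY `𝒞_W > 0` FOR ANY NUMBER OF LETTERS

HONEST FRAMING.  Object-search cell `pub-symmetroid`, seat `val-sym-mdr-p1` (generation 24); helper file `--supports` the crux item
stmt-ValiantsHypothesis-18050 (`Theses.LacunarySymmetroid.MatrixDescartes`, OPEN, on HOLD) with NO closure claim.  PURE ALGEBRA in the
uniform `Finset` currency of `…CriticalWindows` (letters `m ∈ s`, rates `βₘ`, positions `tₘ`, point weights `Wₘ > 0`, a direction `T`):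
the ALL-`K` form of `…CriticalWindowsFourFoldCubic.foldCubic_pos` (generation 23, four letters).  At a point satisfying the two critical
equations (E1) `∑ Wₘ(T² − tₘ²) = 0`, (E2) `∑ βₘWₘ(T − tₘ)² = 0` and the FOLD relation `A·S₂ = 2S₁²`, with a pivot letter `p`
(`βₚ < 0 < βₘ` otherwise, `tₚ < T`), ONE lone letter `j` beyond the direction (`T < tⱼ`) carrying the LARGEST rate, and all remaining
letters (at least one) at positive positions below the pivot, the cubic fold form `𝒞_W = 3B₀S₂² − 6B₂S₁S₂ + 2B₃S₁²` is positive.  This is the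
located all-`K` candidate of memo MOMENT-FOLD.md §5 made kernel; it is the one inequality the fastest-lone-letter law needs at fold points
(memo §4).  No count is proved in THIS file (the analytic assembly for general `K` is the successor files' business); nothing here bears on
`MatrixDescartes` in its window, on `DoorA26`/`DoorA34`, registers / credences, or `VP ≠ VNP`.

THE PROOF = the bridge of the four-letter file, written once for a `Finset`: masses `dₘ = Wₘ(T−tₘ)²`, `U = C·β`, `R = (P(T+tₘ) − Cβₘ(T−tₘ))/(T−tₘ)`
with `C = S_{βg} = ∑βₘWₘ(T²−tₘ²)`, `P = S₂`; the bridge identities (§2, free scalars `C, P`) give `E U = C·(E2)`, `E R = P·(E1) − C·(E2)`,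
`E[UR] = C(P·S_{βg} − C·S₂)`, `E U² − E R² = (∑d)·S₂²` (mod E1, E2, FOLD), `E U³ − 3E[UR²] = −4T²·S_{βg}·𝒞_W` (mod E2), and
`gₘ = Uₘ + Rₘ = S₂(T+tₘ)/(T−tₘ)`; the signs (§1: `S₂ > 0`, `S_{βg} < 0` when the lone letter is fastest) turn the hypotheses of
`…LoneCubicMoment.cubicMoment_pos` into ORDER `tₘ ≤ tₚ` and GAP `tₘ > 0`, and its conclusion into `𝒞_W > 0`.
[folklore] Polynomial identities summed over a `Finset`; sign bookkeeping.  No definitions, no named facts.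
-/

-- `Summit.ValiantsHypothesis.ValiantsHypothesis.…` repeats a component by the D-0017 layout
-- (single-conjunct summit), which the `dupNamespace` linter flags; the name is mandated.
set_option linter.dupNamespace false

namespace Summit.ValiantsHypothesis.ValiantsHypothesis.Theorems.LacunarySymmetroidMatrixDescartes.Pivot.CriticalWindows.Lone

open Finset
open scoped BigOperators

/-! ## 1. Moment identities and signs in the uniform currency -/

/-- **`S_{βg} = 2T·S₁ − (E2)`**: `∑βW(T²−t²) = 2T∑βW(T−t) − ∑βW(T−t)²`. [folklore] -/
theorem mixedMoment_eq {ι : Type*} (s : Finset ι) (β t W : ι → ℝ) (T : ℝ) :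
    ∑ m ∈ s, β m * W m * (T ^ 2 - t m ^ 2)
      = 2 * T * (∑ m ∈ s, β m * W m * (T - t m)) - ∑ m ∈ s, β m * W m * (T - t m) ^ 2 := by
  rw [Finset.mul_sum, ← Finset.sum_sub_distrib]
  exact Finset.sum_congr rfl fun m _ => by ring

/-- **`S₂ > 0`**: for non-negative weights, a letter `j ∈ s` with `Wⱼ > 0`, `βⱼ ≠ 0`, `T ≠ tⱼ` makes `∑β²W(T−t)² > 0`. [folklore] -/
theorem secondMoment_pos {ι : Type*} (s : Finset ι) (β t W : ι → ℝ) (T : ℝ) (j : ι) (hj : j ∈ s)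
    (hW : ∀ m ∈ s, 0 ≤ W m) (hWj : 0 < W j) (hβj : β j ≠ 0) (hTj : T ≠ t j) :
    0 < ∑ m ∈ s, β m ^ 2 * W m * (T - t m) ^ 2 := by
  refine Finset.sum_pos' (fun m hm => mul_nonneg (mul_nonneg (sq_nonneg _) (hW m hm)) (sq_nonneg _)) ⟨j, hj, ?_⟩
  have hu : T - t j ≠ 0 := sub_ne_zero.mpr hTj
  have h1 : 0 < β j ^ 2 := by positivity
  have h2 : 0 < (T - t j) ^ 2 := by positivity
  exact mul_pos (mul_pos h1 hWj) h2

/-- **`S_{βg} < 0` WHEN THE LONE LETTER IS FASTEST.**  Under (E1), with positive weights, every letter other than `j` at a position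
`0 < tₘ < T` and every rate `βₘ ≤ βⱼ` with `βₚ < βⱼ` for some such letter `p`: `∑βW(T²−t²) = ∑(βₘ − βⱼ)WₘAₘ < 0`. [folklore] -/
theorem mixedMoment_neg_of_fastest {ι : Type*} (s : Finset ι) (β t W : ι → ℝ) (T : ℝ) (p j : ι) (hp : p ∈ s) (hpj : p ≠ j)
    (hW : ∀ m ∈ s, 0 < W m) (ht : ∀ m ∈ s, m ≠ j → 0 < t m ∧ t m < T) (hfast : ∀ m ∈ s, β m ≤ β j) (hβp : β p < β j)
    (h1 : ∑ m ∈ s, W m * (T ^ 2 - t m ^ 2) = 0) :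
    ∑ m ∈ s, β m * W m * (T ^ 2 - t m ^ 2) < 0 := by
  classical
  have e : ∑ m ∈ s, β m * W m * (T ^ 2 - t m ^ 2)
      = (∑ m ∈ s, (β m - β j) * W m * (T ^ 2 - t m ^ 2)) + β j * ∑ m ∈ s, W m * (T ^ 2 - t m ^ 2) := by
    rw [Finset.mul_sum, ← Finset.sum_add_distrib]
    exact Finset.sum_congr rfl fun m _ => by ring
  rw [e, h1, mul_zero, add_zero]
  have hle : ∀ m ∈ s, (β m - β j) * W m * (T ^ 2 - t m ^ 2) ≤ 0 := by
    intro m hm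
    by_cases hmj : m = j
    · rw [hmj, sub_self]; simp
    · obtain ⟨h0, hT⟩ := ht m hm hmj
      have hA : 0 < T ^ 2 - t m ^ 2 := by nlinarith
      exact mul_nonpos_of_nonpos_of_nonneg (mul_nonpos_of_nonpos_of_nonneg (by linarith [hfast m hm]) (hW m hm).le) hA.le
  have hlt : (β p - β j) * W p * (T ^ 2 - t p ^ 2) < 0 := by
    obtain ⟨h0, hT⟩ := ht p hp hpj
    have hA : 0 < T ^ 2 - t p ^ 2 := by nlinarith
    exact mul_neg_of_neg_of_pos (mul_neg_of_neg_of_pos (by linarith) (hW p hp)) hA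
  calc ∑ m ∈ s, (β m - β j) * W m * (T ^ 2 - t m ^ 2)
      = (∑ m ∈ s.erase p, (β m - β j) * W m * (T ^ 2 - t m ^ 2)) + (β p - β j) * W p * (T ^ 2 - t p ^ 2) :=
        (Finset.sum_erase_add s _ hp).symm
    _ < 0 := by
        have := Finset.sum_nonpos (fun m (hm : m ∈ s.erase p) => hle m (Finset.mem_of_mem_erase hm))
        linarith

/-! ## 2. Bridge identities (free scalars `C`, `P`; masses `W(T−t)²`, `U = Cβ`, `R = (P(T+t) − Cβ(T−t))/(T−t)`) -/

/-- `∑ d·U = C·(E2)`. [folklore] -/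
theorem bridge_EU {ι : Type*} (s : Finset ι) (β t W : ι → ℝ) (T C : ℝ) :
    ∑ m ∈ s, (W m * (T - t m) ^ 2) * (C * β m) = C * ∑ m ∈ s, β m * W m * (T - t m) ^ 2 := by
  rw [Finset.mul_sum]; exact Finset.sum_congr rfl fun m _ => by ring

/-- `∑ d·R = P·(E1) − C·(E2)`. [folklore] -/
theorem bridge_ER {ι : Type*} (s : Finset ι) (β t W : ι → ℝ) (T C P : ℝ) (hu : ∀ m ∈ s, T - t m ≠ 0) :
    ∑ m ∈ s, (W m * (T - t m) ^ 2) * ((P * (T + t m) - C * β m * (T - t m)) / (T - t m))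
      = P * (∑ m ∈ s, W m * (T ^ 2 - t m ^ 2)) - C * ∑ m ∈ s, β m * W m * (T - t m) ^ 2 := by
  rw [Finset.mul_sum, Finset.mul_sum, ← Finset.sum_sub_distrib]
  refine Finset.sum_congr rfl fun m hm => ?_
  have h := hu m hm
  field_simp
  ring

/-- `∑ d·U·R = C·(P·S_{βg} − C·S₂)`. [folklore] -/
theorem bridge_EUR {ι : Type*} (s : Finset ι) (β t W : ι → ℝ) (T C P : ℝ) (hu : ∀ m ∈ s, T - t m ≠ 0) :
    ∑ m ∈ s, (W m * (T - t m) ^ 2) * (C * β m) * ((P * (T + t m) - C * β m * (T - t m)) / (T - t m))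
      = C * (P * (∑ m ∈ s, β m * W m * (T ^ 2 - t m ^ 2)) - C * ∑ m ∈ s, β m ^ 2 * W m * (T - t m) ^ 2) := by
  rw [Finset.mul_sum, Finset.mul_sum, ← Finset.sum_sub_distrib, Finset.mul_sum]
  refine Finset.sum_congr rfl fun m hm => ?_
  have h := hu m hm
  field_simp
  ring

/-- `∑ d·U² = C²·S₂`. [folklore] -/
theorem bridge_U2 {ι : Type*} (s : Finset ι) (β t W : ι → ℝ) (T C : ℝ) :
    ∑ m ∈ s, (W m * (T - t m) ^ 2) * (C * β m) ^ 2 = C ^ 2 * ∑ m ∈ s, β m ^ 2 * W m * (T - t m) ^ 2 := by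
  rw [Finset.mul_sum]; exact Finset.sum_congr rfl fun m _ => by ring

/-- `∑ d·R² = P²·∑W(T+t)² − 2PC·S_{βg} + C²·S₂`. [folklore] -/
theorem bridge_R2 {ι : Type*} (s : Finset ι) (β t W : ι → ℝ) (T C P : ℝ) (hu : ∀ m ∈ s, T - t m ≠ 0) :
    ∑ m ∈ s, (W m * (T - t m) ^ 2) * ((P * (T + t m) - C * β m * (T - t m)) / (T - t m)) ^ 2
      = P ^ 2 * (∑ m ∈ s, W m * (T + t m) ^ 2) - 2 * P * C * (∑ m ∈ s, β m * W m * (T ^ 2 - t m ^ 2))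
        + C ^ 2 * ∑ m ∈ s, β m ^ 2 * W m * (T - t m) ^ 2 := by
  rw [Finset.mul_sum, Finset.mul_sum, Finset.mul_sum, ← Finset.sum_sub_distrib, ← Finset.sum_add_distrib]
  refine Finset.sum_congr rfl fun m hm => ?_
  have h := hu m hm
  field_simp
  ring

/-- `∑ d·U³ = C³·B₃`. [folklore] -/
theorem bridge_U3 {ι : Type*} (s : Finset ι) (β t W : ι → ℝ) (T C : ℝ) :
    ∑ m ∈ s, (W m * (T - t m) ^ 2) * (C * β m) ^ 3 = C ^ 3 * ∑ m ∈ s, β m ^ 3 * W m * (T - t m) ^ 2 := by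
  rw [Finset.mul_sum]; exact Finset.sum_congr rfl fun m _ => by ring

/-- `∑ d·U·R² = C·(P²·∑βW(T+t)² − 2PC·∑β²W(T−t)(T+t) + C²·B₃)`. [folklore] -/
theorem bridge_UR2 {ι : Type*} (s : Finset ι) (β t W : ι → ℝ) (T C P : ℝ) (hu : ∀ m ∈ s, T - t m ≠ 0) :
    ∑ m ∈ s, (W m * (T - t m) ^ 2) * (C * β m) * ((P * (T + t m) - C * β m * (T - t m)) / (T - t m)) ^ 2
      = C * (P ^ 2 * (∑ m ∈ s, β m * W m * (T + t m) ^ 2) - 2 * P * C * (∑ m ∈ s, β m ^ 2 * W m * ((T - t m) * (T + t m)))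
        + C ^ 2 * ∑ m ∈ s, β m ^ 3 * W m * (T - t m) ^ 2) := by
  rw [Finset.mul_sum, Finset.mul_sum, Finset.mul_sum, ← Finset.sum_sub_distrib, ← Finset.sum_add_distrib, Finset.mul_sum]
  refine Finset.sum_congr rfl fun m hm => ?_
  have h := hu m hm
  field_simp
  ring

/-- `∑W(T+t)² = 4T²·A − 2·(E1) − ∑W(T−t)²`. [folklore] -/
theorem aux_Q {ι : Type*} (s : Finset ι) (t W : ι → ℝ) (T : ℝ) :
    ∑ m ∈ s, W m * (T + t m) ^ 2
      = 4 * T ^ 2 * (∑ m ∈ s, W m) - 2 * (∑ m ∈ s, W m * (T ^ 2 - t m ^ 2)) - ∑ m ∈ s, W m * (T - t m) ^ 2 := by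
  rw [Finset.mul_sum, Finset.mul_sum, ← Finset.sum_sub_distrib, ← Finset.sum_sub_distrib]
  exact Finset.sum_congr rfl fun m _ => by ring

/-- `∑βW(T+t)² = 4T²·B₀ − 4T·S₁ + (E2)`. [folklore] -/
theorem aux_Q1 {ι : Type*} (s : Finset ι) (β t W : ι → ℝ) (T : ℝ) :
    ∑ m ∈ s, β m * W m * (T + t m) ^ 2
      = 4 * T ^ 2 * (∑ m ∈ s, β m * W m) - 4 * T * (∑ m ∈ s, β m * W m * (T - t m)) + ∑ m ∈ s, β m * W m * (T - t m) ^ 2 := by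
  rw [Finset.mul_sum, Finset.mul_sum, ← Finset.sum_sub_distrib, ← Finset.sum_add_distrib]
  exact Finset.sum_congr rfl fun m _ => by ring

/-- `∑β²W(T−t)(T+t) = 2T·B₂ − S₂`. [folklore] -/
theorem aux_Q2 {ι : Type*} (s : Finset ι) (β t W : ι → ℝ) (T : ℝ) :
    ∑ m ∈ s, β m ^ 2 * W m * ((T - t m) * (T + t m))
      = 2 * T * (∑ m ∈ s, β m ^ 2 * W m * (T - t m)) - ∑ m ∈ s, β m ^ 2 * W m * (T - t m) ^ 2 := by
  rw [Finset.mul_sum, ← Finset.sum_sub_distrib]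
  exact Finset.sum_congr rfl fun m _ => by ring

/-- Per atom, `U + R = P·(T+t)/(T−t)`. [folklore] -/
theorem atom_g (C P b t T : ℝ) (hu : T - t ≠ 0) :
    C * b + (P * (T + t) - C * b * (T - t)) / (T - t) = P * ((T + t) / (T - t)) := by
  field_simp
  ring

/-! ## 3. The cubic fold form is positive at fold points (any number of letters) -/

/-- **`𝒞_W > 0` AT FOLD POINTS, ANY NUMBER OF LETTERS.**  Letters `m ∈ s` with point weights `Wₘ > 0`; a pivot `p ∈ s` with `βₚ < 0`, all
other rates positive; a lone letter `j ∈ s`, `j ≠ p`, of the largest rate (`βₘ ≤ βⱼ` for all `m`); positions: `0 < tₘ` for every letter,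
`tₘ ≤ tₚ` for the left letters (`m ≠ p, j`; at least one), and `tₚ < T < tⱼ`.  If (E1), (E2) and the fold relation `A·S₂ = 2S₁²` hold at `T`,
then `3B₀S₂² − 6B₂S₁S₂ + 2B₃S₁² > 0`. [folklore] -/
theorem foldCubic_pos {ι : Type*} (s : Finset ι) (β t W : ι → ℝ) (T : ℝ) (p j : ι)
    (hp : p ∈ s) (hj : j ∈ s) (hpj : p ≠ j) (hleft : ∃ m ∈ s, m ≠ p ∧ m ≠ j)
    (hW : ∀ m ∈ s, 0 < W m) (hβp : β p < 0) (hβ : ∀ m ∈ s, m ≠ p → 0 < β m) (hfast : ∀ m ∈ s, β m ≤ β j)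
    (ht : ∀ m ∈ s, 0 < t m) (htp : ∀ m ∈ s, m ≠ p → m ≠ j → t m ≤ t p) (hpT : t p < T) (hTj : T < t j)
    (h1 : ∑ m ∈ s, W m * (T ^ 2 - t m ^ 2) = 0) (h2 : ∑ m ∈ s, β m * W m * (T - t m) ^ 2 = 0)
    (hfold : (∑ m ∈ s, W m) * (∑ m ∈ s, β m ^ 2 * W m * (T - t m) ^ 2) = 2 * (∑ m ∈ s, β m * W m * (T - t m)) ^ 2) :
    0 < 3 * (∑ m ∈ s, β m * W m) * (∑ m ∈ s, β m ^ 2 * W m * (T - t m) ^ 2) ^ 2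
        - 6 * (∑ m ∈ s, β m ^ 2 * W m * (T - t m)) * (∑ m ∈ s, β m * W m * (T - t m)) * (∑ m ∈ s, β m ^ 2 * W m * (T - t m) ^ 2)
        + 2 * (∑ m ∈ s, β m ^ 3 * W m * (T - t m) ^ 2) * (∑ m ∈ s, β m * W m * (T - t m)) ^ 2 := by
  -- positions relative to the direction
  have hleft_lt : ∀ m ∈ s, m ≠ j → 0 < t m ∧ t m < T := by
    intro m hm hmj
    refine ⟨ht m hm, ?_⟩
    by_cases hmp : m = p
    · rw [hmp]; exact hpT
    · exact lt_of_le_of_lt (htp m hm hmp hmj) hpT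
  have hu : ∀ m ∈ s, T - t m ≠ 0 := by
    intro m hm
    by_cases hmj : m = j
    · rw [hmj]; exact ne_of_lt (by linarith)
    · exact ne_of_gt (by linarith [(hleft_lt m hm hmj).2])
  have hT : 0 < T := lt_trans (ht p hp) hpT
  -- names for the basic sums
  set A := ∑ m ∈ s, W m with hA
  set S1 := ∑ m ∈ s, β m * W m * (T - t m) with hS1
  set S2 := ∑ m ∈ s, β m ^ 2 * W m * (T - t m) ^ 2 with hS2
  set Sbg := ∑ m ∈ s, β m * W m * (T ^ 2 - t m ^ 2) with hSbg
  set B0 := ∑ m ∈ s, β m * W m with hB0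
  set B2 := ∑ m ∈ s, β m ^ 2 * W m * (T - t m) with hB2
  set B3 := ∑ m ∈ s, β m ^ 3 * W m * (T - t m) ^ 2 with hB3
  set M := ∑ m ∈ s, W m * (T - t m) ^ 2 with hM
  -- signs of the basic sums
  have hβj : 0 < β j := hβ j hj hpj.symm
  have hS2pos : 0 < S2 := secondMoment_pos s β t W T j hj (fun m hm => (hW m hm).le) (hW j hj) (ne_of_gt hβj) (ne_of_lt hTj)
  have hSbg_neg : Sbg < 0 :=
    mixedMoment_neg_of_fastest s β t W T p j hp hpj hW hleft_lt hfast (lt_trans hβp hβj) h1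
  have hSbg_eq : Sbg = 2 * T * S1 := by
    have := mixedMoment_eq s β t W T
    rw [h2, sub_zero] at this
    exact this
  have hMpos : 0 < M := by
    refine Finset.sum_pos' (fun m hm => mul_nonneg (hW m hm).le (sq_nonneg _)) ⟨p, hp, ?_⟩
    exact mul_pos (hW p hp) (pow_pos (by linarith) 2)
  -- the abstract data
  have hd : ∀ m ∈ s, 0 < W m * (T - t m) ^ 2 := by
    intro m hm
    have h := hu m hm
    have : 0 < (T - t m) ^ 2 := by positivity
    exact mul_pos (hW m hm) this
  have hUneg : ∀ m ∈ s, m ≠ p → Sbg * β m < 0 := fun m hm hmp => mul_neg_of_neg_of_pos hSbg_neg (hβ m hm hmp)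
  have hUj : ∀ m ∈ s, Sbg * β j ≤ Sbg * β m := fun m hm => mul_le_mul_of_nonpos_left (hfast m hm) hSbg_neg.le
  have hEU : ∑ m ∈ s, (W m * (T - t m) ^ 2) * (Sbg * β m) = 0 := by
    rw [bridge_EU s β t W T Sbg, h2, mul_zero]
  have hER : ∑ m ∈ s, (W m * (T - t m) ^ 2) * ((S2 * (T + t m) - Sbg * β m * (T - t m)) / (T - t m)) = 0 := by
    rw [bridge_ER s β t W T Sbg S2 hu, h1, h2, mul_zero, mul_zero, sub_zero]
  have hEUR : ∑ m ∈ s, (W m * (T - t m) ^ 2) * (Sbg * β m) * ((S2 * (T + t m) - Sbg * β m * (T - t m)) / (T - t m)) = 0 := by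
    rw [bridge_EUR s β t W T Sbg S2 hu, ← hSbg, ← hS2]
    ring
  -- the `g`'s
  have hg : ∀ m ∈ s, Sbg * β m + (S2 * (T + t m) - Sbg * β m * (T - t m)) / (T - t m) = S2 * ((T + t m) / (T - t m)) :=
    fun m hm => atom_g Sbg S2 (β m) (t m) T (hu m hm)
  have hgpos : ∀ m ∈ s, m ≠ p → m ≠ j → 0 ≤ Sbg * β m + (S2 * (T + t m) - Sbg * β m * (T - t m)) / (T - t m) := by
    intro m hm hmp hmj
    rw [hg m hm]
    obtain ⟨h0, hlt⟩ := hleft_lt m hm hmj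
    exact (mul_pos hS2pos (div_pos (by linarith) (by linarith))).le
  have horder : ∀ m ∈ s, m ≠ p → m ≠ j → Sbg * β m + (S2 * (T + t m) - Sbg * β m * (T - t m)) / (T - t m)
      ≤ Sbg * β p + (S2 * (T + t p) - Sbg * β p * (T - t p)) / (T - t p) := by
    intro m hm hmp hmj
    rw [hg m hm, hg p hp]
    refine mul_le_mul_of_nonneg_left ?_ hS2pos.le
    obtain ⟨h0, hlt⟩ := hleft_lt m hm hmj
    have hmp' := htp m hm hmp hmj
    rw [div_le_div_iff₀ (by linarith) (by linarith)]
    have e : (T + t p) * (T - t m) - (T + t m) * (T - t p) = 2 * T * (t p - t m) := by ring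
    have : 0 ≤ 2 * T * (t p - t m) := mul_nonneg (by linarith) (by linarith)
    linarith
  -- the GAP from the fold relation
  have hQR : (∑ m ∈ s, (W m * (T - t m) ^ 2) * (Sbg * β m) ^ 2)
      - (∑ m ∈ s, (W m * (T - t m) ^ 2) * ((S2 * (T + t m) - Sbg * β m * (T - t m)) / (T - t m)) ^ 2) = M * S2 ^ 2 := by
    rw [bridge_U2 s β t W T Sbg, bridge_R2 s β t W T Sbg S2 hu, aux_Q s t W T, h1, ← hS2, ← hSbg, ← hA, ← hM]
    have hf : A * S2 - 2 * S1 ^ 2 = 0 := by rw [hfold]; ring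
    linear_combination (2 * S2 * (Sbg + 2 * T * S1)) * hSbg_eq + (-(4 * T ^ 2 * S2)) * hf
  have hgap : ∀ m ∈ s, m ≠ p → m ≠ j →
      (∑ n ∈ s, (W n * (T - t n) ^ 2) * (Sbg * β n) ^ 2)
        - (∑ n ∈ s, (W n * (T - t n) ^ 2) * ((S2 * (T + t n) - Sbg * β n * (T - t n)) / (T - t n)) ^ 2)
        < (∑ n ∈ s, W n * (T - t n) ^ 2) * (Sbg * β m + (S2 * (T + t m) - Sbg * β m * (T - t m)) / (T - t m)) ^ 2 := by
    intro m hm hmp hmj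
    rw [hQR, ← hM, hg m hm]
    obtain ⟨h0, hlt⟩ := hleft_lt m hm hmj
    have hg1 : 1 < (T + t m) / (T - t m) := by rw [lt_div_iff₀ (by linarith)]; linarith
    have hg2 : 1 < ((T + t m) / (T - t m)) ^ 2 := one_lt_pow₀ hg1 two_ne_zero
    have hposM : 0 < M * S2 ^ 2 := mul_pos hMpos (pow_pos hS2pos 2)
    have hlt2 := mul_lt_mul_of_pos_left hg2 hposM
    calc M * S2 ^ 2 = M * S2 ^ 2 * 1 := (mul_one _).symm
      _ < M * S2 ^ 2 * ((T + t m) / (T - t m)) ^ 2 := hlt2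
      _ = M * (S2 * ((T + t m) / (T - t m))) ^ 2 := by ring
  -- the abstract inequality
  have main := cubicMoment_pos s (fun m => W m * (T - t m) ^ 2) (fun m => Sbg * β m)
    (fun m => (S2 * (T + t m) - Sbg * β m * (T - t m)) / (T - t m)) p j hp hj hpj hleft hd hUneg hUj hEU hER hEUR hgpos horder hgap
  -- translate the conclusion
  rw [bridge_U3 s β t W T Sbg, bridge_UR2 s β t W T Sbg S2 hu, aux_Q1 s β t W T, aux_Q2 s β t W T, h2, add_zero,
    ← hB3, ← hB0, ← hS1, ← hB2, ← hS2] at main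
  rw [hSbg_eq] at main
  have key : (2 * T * S1) ^ 3 * B3 - 3 * (2 * T * S1 * ((S2 ^ 2 * (4 * T ^ 2 * B0 - 4 * T * S1)
      - 2 * S2 * (2 * T * S1) * (2 * T * B2 - S2) + (2 * T * S1) ^ 2 * B3)))
      = (-(8 * T ^ 3 * S1)) * (3 * B0 * S2 ^ 2 - 6 * B2 * S1 * S2 + 2 * B3 * S1 ^ 2) := by ring
  rw [key] at main
  have hS1neg : S1 < 0 := by
    rw [hSbg_eq] at hSbg_neg
    by_contra hcon
    push Not at hcon
    have : 0 ≤ 2 * T * S1 := mul_nonneg (by linarith) hcon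
    linarith
  have hcoef : 0 < -(8 * T ^ 3 * S1) := by
    have : 8 * T ^ 3 * S1 < 0 := mul_neg_of_pos_of_neg (by positivity) hS1neg
    linarith
  exact pos_of_mul_pos_right main hcoef.le

end Summit.ValiantsHypothesis.ValiantsHypothesis.Theorems.LacunarySymmetroidMatrixDescartes.Pivot.CriticalWindows.Lone
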